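import Summits.QuantumFields.YangMills.Theorems.UnitScaleTiltFluctuationComparisonRegPrPosOnSmallReduction
import Summits.QuantumFields.YangMills.Theorems.UnitScaleTiltFluctuationComparisonRegPrSubmersionEngine
import Summits.QuantumFields.YangMills.Theorems.UnitScaleTiltFluctuationComparisonRegPrSU2ParametricSubmersion
import Summits.QuantumFields.YangMills.Theorems.UnitScaleTiltFluctuationComparisonRegPrEMLFibreSubmersion
import Literature.MathematicalPhysics.QuantumFieldTheory.Balaban1983to89.BlockAveragingEMLHaarAC
import Literature.MathematicalPhysics.QuantumFieldTheory.Balaban1983to89.BlockAveragingExpMeanLogContinuous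
import Literature.MathematicalPhysics.QuantumFieldTheory.Balaban1983to89.BlockAveragingPlaquetteBound

/-!
# Route `UnitScaleTilt` — crux K1bR-pr `FluctuationComparisonRegPr` (stmt-QuantumFields-19201), «Lemma B» line, step S-B3:
# ONE STEP OF BAŁABAN'S (0.4) AVERAGING WITH THE PRINTED `exp[mean log]` ON `SU(2)` IS AN OPEN MAP AND MEASURE-OPEN ON THE
# SMALL FIELDS — the one-step submersion (O) ∧ (N), PROVED (support file `--supports stmt-QuantumFields-19201`)

Fleet lead `ym-ust-19201-p1` (gen 0).  Assembly of the three engines landed for this line — the fibrewise submersion engine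
(`FibrewiseSubmersion.isOpen_image_and_measureOpen_of_fibrewise`), the parametric inverse function theorem on `SU(2)` in the cone picture
(`SU2ParametricSubmersion.su2_fibrewise_of_hasStrictFDerivAt'`) and the analytic datum of the exp-mean-log fibre map
(`EMLFibreSubmersion.exists_strictFDeriv_coneKf`, `contDiffAt_coneKf`) — with the central-bond normal form of (0.4) of
`BlockAveragingHaarAC`/`BlockAveragingEMLHaarAC` (FACT (A): `isLocal_avgFun`, `centralBond_injective`; `Ū′(c) = fibreMap (pre·g·post)`,
`avgFun_update_centralBond_self`; on the guard `↑(fibreMap W) = exp(Σ_k |I|⁻¹ log(h_k W*))·W`, `coe_fibreCore_eq`):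

**`oneStepSubmersion`** — on a torus in the standing range `j + 1 ≤ m + K` and for a radius `δ₁ ≥ 0` with `((d+2)L)²δ₁/4 < δ₂ = 1/3` (every
loop variable of a `δ₁`-small field is in the guard, `LatticeWordStokes.small_of_plaqSmall`), for every OPEN `O ⊆ {PlaqSmall δ₁}`:
(O) `Ū(O) = avgFun ℰp '' O` is OPEN, and (N) `dU(O ∩ Ū⁻¹N) = 0 ⇒ dV(N ∩ Ū(O)) = 0` for measurable `N` (product Haar measures).
These are exactly the hypotheses (O) ∧ (N) of the landed reduction `PosOnSmallReduction.posOnSmall_of_smallLift_of_oneStepSubmersion`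
and §4 draws the consequences for the families: `oneStepSubmersion_family` (the hypothesis `hsub` of that reduction, PROVED),
**`fibrePositivityBelow`** («Lemma B» below a radius — the honest cut of v2's `stub_fibrePositivity` — PROVED) and
**`posOnSmall_of_oneStepSmallLift`**: the registered `posOnSmall` (old `stub_posOnSmall`) from `stub_oneStepSmallLift`'s statement ALONE.  Every declaration is [folklore] measure theory / calculus about the
published formula (0.4); nothing of Bałaban's is asserted.
-/

noncomputable section

open MeasureTheory Set Metric Function Filter NormedSpace
open scoped RealInnerProductSpace Topology Quaternion

namespace Summit.QuantumFields.YangMills.Theorems.OneStepSubmersion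

open Literature.MathematicalPhysics.QuantumFieldTheory (haarProbability)
open Literature.MathematicalPhysics.QuantumFieldTheory.Balaban1983to89
open Literature.MathematicalPhysics.QuantumFieldTheory.Balaban1983to89.T4Continuum
open Literature.MathematicalPhysics.QuantumFieldTheory.Balaban1983to89.AveragingRT
open Literature.MathematicalPhysics.QuantumFieldTheory.Balaban1983to89.BlockAveraging
open Literature.MathematicalPhysics.QuantumFieldTheory.Balaban1983to89.BlockAveragingHaarAC
open Literature.MathematicalPhysics.QuantumFieldTheory.Balaban1983to89.BlockAveragingEMLHaarAC
open Literature.MathematicalPhysics.QuantumFieldTheory.Balaban1983to89.ExpMeanLog (expMeanLogSU deltaSU deltaSU_pos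
  measurable_expMeanLogSU_E)
open Literature.MathematicalPhysics.QuantumFieldTheory.Balaban1983to89.T4QuatExpLog (quatMatrix_exp quatMatrix_qlog norm_quatMatrix_sub_one)
open Literature.MathematicalPhysics.QuantumFieldTheory.Balaban1983to89.T4EMLFibreAC (kf Yf coe_mul_star_coe_quatToSU2)
open Literature.MathematicalPhysics.QuantumFieldTheory.Balaban1983to89.T4HaarSU2Translate (su2Quat_quatToSU2 continuous_su2Quat
  measurable_su2Quat su2Quat_eq_of_coe_eq su2Quat_mul quatMatrix_sum haarData_haar_eq)
open Literature.MathematicalPhysics.QuantumLattice (quatMatrix quatMatrix_mul quatMatrix_smul su2Quat norm_su2Quat quatToSU2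
  quatToSU2_su2Quat quatMatrix_su2Quat coe_quatToSU2_of_norm_eq_one)
open Summit.QuantumFields.YangMills.Theorems.FibrewiseSubmersion
open Summit.QuantumFields.YangMills.Theorems.SU2ParametricSubmersion
open Summit.QuantumFields.YangMills.Theorems.EMLFibreSubmersion

variable {P : Params} {j : ℕ}

/-! ## §1 The guard on small fields; the representation of the one-variable law by the cone datum -/

/-- A `δ₁`-small field with `((d+2)L)²δ₁/4 < δ₂` has all its (0.4) loop variables in the guard at every coarse bond. [cite: Balaban1987RG1, (0.4) p.253] -/
theorem small_of_mem {δ₁ : ℝ} (hδ : 0 ≤ δ₁) (hτ : ((((P.d + 2) * P.L : ℕ) : ℝ) ^ 2 / 4) * δ₁ < deltaSU (Fin 2))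
    {U : GaugeField P j (Matrix.specialUnitaryGroup (Fin 2) ℂ)} (hU : PlaqSmall δ₁ U) (c : PBond P (j + 1)) :
    Small expMeanLogSU U c :=
  LatticeWordStokes.small_of_plaqSmall expMeanLogSU hδ hU hτ c

/-- **THE ONE-VARIABLE LAW IN THE QUATERNION MODEL**: on the guard, `su2Quat (fibreMap W) = kf a c (su2Quat W)` with `a_k = su2Quat h_k`
(the off-central open holonomies) and the uniform weights `|I|⁻¹`. [cite: Balaban1987RG1, (0.4) p.253] -/
theorem su2Quat_fibreMap_eq_kf (U : GaugeField P j (Matrix.specialUnitaryGroup (Fin 2) ℂ)) (c : PBond P (j + 1))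
    {W : Matrix.specialUnitaryGroup (Fin 2) ℂ} (hW : W ∈ fibreGuard expMeanLogSU U c) :
    su2Quat (fibreMap expMeanLogSU U c W) =
      kf (fun k : Fin (offCard c) => su2Quat (offHol U c k)) (fun _ => emlWeight P) (su2Quat W) := by
  apply su2Quat_eq_of_coe_eq
  have hu : ‖su2Quat W‖ = 1 := norm_su2Quat W
  have hq : quatToSU2 (su2Quat W) = W := quatToSU2_su2Quat W
  rw [fibreMap_of_mem _ U c hW, coe_fibreCore_eq U c hW, kf, quatMatrix_mul, quatMatrix_exp, quatMatrix_su2Quat]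
  congr 2
  rw [Yf, quatMatrix_sum]
  refine Finset.sum_congr rfl fun k _ => ?_
  have hg : ‖su2Quat (offHol U c k) * star (su2Quat W) - 1‖ < 1 := by
    have h1 := norm_offHol_mul_star_sub_one_lt U c hW k
    rw [← hq, coe_mul_star_coe_quatToSU2 (offHol U c k) hu, norm_quatMatrix_sub_one] at h1
    exact h1.trans (by norm_num)
  rw [quatMatrix_smul, quatMatrix_qlog hg, ← hq, coe_mul_star_coe_quatToSU2 (offHol U c k) hu, hq]

/-- On the guard, `‖a_k · (su2Quat W)^* − 1‖ < 1/3` for the quaternion environment `a_k = su2Quat h_k`. [folklore] -/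
theorem norm_env_mul_star_sub_one_lt (U : GaugeField P j (Matrix.specialUnitaryGroup (Fin 2) ℂ)) (c : PBond P (j + 1))
    {W : Matrix.specialUnitaryGroup (Fin 2) ℂ} (hW : W ∈ fibreGuard expMeanLogSU U c) (k : Fin (offCard c)) :
    ‖su2Quat (offHol U c k) * star (su2Quat W) - 1‖ < 1 / 3 := by
  have h1 := norm_offHol_mul_star_sub_one_lt U c hW k
  rwa [← quatToSU2_su2Quat W, coe_mul_star_coe_quatToSU2 (offHol U c k) (norm_su2Quat W), norm_quatMatrix_sub_one] at h1

/-- The quaternion environment `η U = (su2Quat ∘ h(U), su2Quat (pre U), su2Quat (post U))` of the coarse bond `c` is continuous in the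
configuration (finite products in the topological group `SU(2)`). [folklore] -/
theorem continuous_env (c : PBond P (j + 1)) :
    Continuous fun U : GaugeField P j (Matrix.specialUnitaryGroup (Fin 2) ℂ) =>
      ((fun k : Fin (offCard c) => su2Quat (offHol U c k)), (su2Quat (pre U c), su2Quat (post U c))) := by
  refine (continuous_pi fun k => continuous_su2Quat.comp (continuous_holAt _)).prodMk
    ((continuous_su2Quat.comp (continuous_holAt _)).prodMk (continuous_su2Quat.comp (continuous_holAt _)))

/-- **THE CONE DATUM REPRESENTS THE ONE-VARIABLE LAW**: if `U[β(c) ↦ g]` is in the guard at `c`, then for every `x ≠ 0` over `g`,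
`‖x‖ • kf a c (p x̂ q) = ‖x‖ • su2Quat (Ū[β(c) ↦ g](c))`, `x̂ = x/‖x‖ = su2Quat g`. [cite: Balaban1987RG1, (0.4) p.253] -/
theorem coneKf_env_eq [DecidableEq (PBond P j)] (hj : j + 1 ≤ P.m + P.K) (U : GaugeField P j (Matrix.specialUnitaryGroup (Fin 2) ℂ))
    (c : PBond P (j + 1)) {x : ℍ} (hx : x ≠ 0) (hsm : Small expMeanLogSU (update U (centralBond c) (quatToSU2 x)) c) :
    ‖x‖ • kf (fun k : Fin (offCard c) => su2Quat (offHol U c k)) (fun _ => emlWeight P)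
        (su2Quat (pre U c) * (‖x‖⁻¹ • x) * su2Quat (post U c)) =
      ‖x‖ • su2Quat (avgFun expMeanLogSU (update U (centralBond c) (quatToSU2 x)) c) := by
  have hW : pre U c * quatToSU2 x * post U c ∈ fibreGuard expMeanLogSU U c :=
    (small_update_centralBond_self_iff hj expMeanLogSU U c (quatToSU2 x)).mp hsm
  rw [avgFun_update_centralBond_self hj expMeanLogSU U c (quatToSU2 x), su2Quat_fibreMap_eq_kf U c hW, su2Quat_mul, su2Quat_mul,
    su2Quat_quatToSU2 hx]

/-! ## §2 The fibrewise hypothesis (FIB) of the engine, for (0.4) on the small fields -/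

/-- **(FIB) FOR BAŁABAN'S AVERAGING ON THE SMALL FIELDS.**  Standing range, `G = SU(2)`, printed `exp[mean log]`, radius `δ₁ ≥ 0` with
`((d+2)L)²δ₁/4 < δ₂`: at every `δ₁`-small `V₀` the one-variable laws `g ↦ Ū[β(c) ↦ g](c)` satisfy the fibrewise hypothesis of
`FibrewiseSubmersion.isOpen_image_and_measureOpen_of_fibrewise` (robust local surjectivity and reverse absolute continuity, uniformly for
environments near `V₀`). [folklore] -/
theorem fibrewise_avgFun [DecidableEq (PBond P j)] (hj : j + 1 ≤ P.m + P.K) {δ₁ : ℝ} (hδ : 0 ≤ δ₁)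
    (hτ : ((((P.d + 2) * P.L : ℕ) : ℝ) ^ 2 / 4) * δ₁ < deltaSU (Fin 2)) :
    ∀ V₀ ∈ {U : GaugeField P j (Matrix.specialUnitaryGroup (Fin 2) ℂ) | PlaqSmall δ₁ U},
      ∀ 𝒰₁ : Set (GaugeField P j (Matrix.specialUnitaryGroup (Fin 2) ℂ)), IsOpen 𝒰₁ → V₀ ∈ 𝒰₁ →
      ∀ B₁ : PBond P (j + 1) → Set (Matrix.specialUnitaryGroup (Fin 2) ℂ), (∀ c, IsOpen (B₁ c) ∧ V₀ (centralBond c) ∈ B₁ c) →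
        ∃ 𝒰 : Set (GaugeField P j (Matrix.specialUnitaryGroup (Fin 2) ℂ)), IsOpen 𝒰 ∧ V₀ ∈ 𝒰 ∧ 𝒰 ⊆ 𝒰₁ ∧
          ∃ B W : PBond P (j + 1) → Set (Matrix.specialUnitaryGroup (Fin 2) ℂ),
          (∀ c, V₀ (centralBond c) ∈ B c ∧ B c ⊆ B₁ c ∧ IsOpen (W c) ∧ avgFun expMeanLogSU V₀ c ∈ W c) ∧
          ∀ U ∈ 𝒰, ∀ c, W c ⊆ (fun g => avgFun expMeanLogSU (update U (centralBond c) g) c) '' (B c) ∧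
            (HaarData.haar : Measure (Matrix.specialUnitaryGroup (Fin 2) ℂ)).restrict (W c) ≪
              ((HaarData.haar : Measure (Matrix.specialUnitaryGroup (Fin 2) ℂ)).restrict (B c)).map
                (fun g => avgFun expMeanLogSU (update U (centralBond c) g) c) := by
  intro V₀ hV₀ 𝒰₁ h𝒰₁ hV𝒰₁ B₁ hB₁
  haveI := Literature.MathematicalPhysics.QuantumLattice.secondCountableTopology_su2
  -- the small-field region is open and contains `V₀ = V₀[β(c) ↦ V₀(β c)]`
  set D : Set (GaugeField P j (Matrix.specialUnitaryGroup (Fin 2) ℂ)) := {U | PlaqSmall δ₁ U} with hD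
  have hDo : IsOpen D := FibrePositivity.isOpen_setOf_plaqSmall δ₁
  -- per coarse bond: the parametric inverse function theorem
  have perBond : ∀ c : PBond P (j + 1), ∃ 𝒰c ∈ 𝓝 V₀, ∃ B W : Set (Matrix.specialUnitaryGroup (Fin 2) ℂ),
      V₀ (centralBond c) ∈ B ∧ B ⊆ B₁ c ∧ IsOpen W ∧ avgFun expMeanLogSU V₀ c ∈ W ∧
      ∀ U ∈ 𝒰c, W ⊆ (fun g => avgFun expMeanLogSU (update U (centralBond c) g) c) '' B ∧
        (haarProbability (Matrix.specialUnitaryGroup (Fin 2) ℂ)).restrict W ≪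
          ((haarProbability (Matrix.specialUnitaryGroup (Fin 2) ℂ)).restrict B).map
            (fun g => avgFun expMeanLogSU (update U (centralBond c) g) c) := by
    intro c
    set g₀ : Matrix.specialUnitaryGroup (Fin 2) ℂ := V₀ (centralBond c) with hg₀
    set u₀ : ℍ := su2Quat g₀ with hu₀_def
    have hu₀ : ‖u₀‖ = 1 := norm_su2Quat g₀
    have hu₀0 : u₀ ≠ 0 := fun h => by rw [h, norm_zero] at hu₀; exact zero_ne_one hu₀
    -- environment map and weights
    set η : GaugeField P j (Matrix.specialUnitaryGroup (Fin 2) ℂ) → (Fin (offCard c) → ℍ) × ℍ × ℍ :=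
      fun U => ((fun k => su2Quat (offHol U c k)), (su2Quat (pre U c), su2Quat (post U c))) with hη
    have hηc : Continuous η := continuous_env c
    set w : Fin (offCard c) → ℝ := fun _ => emlWeight P with hw
    -- a product neighbourhood `𝒰₂ × S` of `(V₀, g₀)` on which `U[β(c) ↦ g]` stays small
    have hupd : Continuous fun p : GaugeField P j (Matrix.specialUnitaryGroup (Fin 2) ℂ) × Matrix.specialUnitaryGroup (Fin 2) ℂ =>
        update p.1 (centralBond c) p.2 :=
      continuous_fst.update _ continuous_snd
    have hV₀upd : update V₀ (centralBond c) g₀ = V₀ := update_eq_self _ V₀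
    have hpre : IsOpen ((fun p : GaugeField P j (Matrix.specialUnitaryGroup (Fin 2) ℂ) × Matrix.specialUnitaryGroup (Fin 2) ℂ =>
        update p.1 (centralBond c) p.2) ⁻¹' D) := hupd.isOpen_preimage D hDo
    obtain ⟨𝒰₂, S, h𝒰₂, hS, hV𝒰₂, hgS, hprod⟩ :=
      isOpen_prod_iff.mp hpre V₀ g₀ (by show update V₀ (centralBond c) g₀ ∈ D; rw [hV₀upd]; exact hV₀)
    have hsmall : ∀ U ∈ 𝒰₂, ∀ g ∈ S, Small expMeanLogSU (update U (centralBond c) g) c :=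
      fun U hU g hg => small_of_mem hδ hτ (hprod (Set.mk_mem_prod hU hg)) c
    -- the guard at the base point
    have hW₀ : pre V₀ c * g₀ * post V₀ c ∈ fibreGuard expMeanLogSU V₀ c :=
      (small_update_centralBond_self_iff hj expMeanLogSU V₀ c g₀).mp (hsmall V₀ hV𝒰₂ g₀ hgS)
    have hpu₀ : su2Quat (pre V₀ c) * u₀ * su2Quat (post V₀ c) = su2Quat (pre V₀ c * g₀ * post V₀ c) := by
      rw [su2Quat_mul, su2Quat_mul]
    have hg₀guard : ∀ k, ‖(η V₀).1 k * star ((η V₀).2.1 * u₀ * (η V₀).2.2) - 1‖ < 1 / 2 := fun k => by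
      show ‖su2Quat (offHol V₀ c k) * star (su2Quat (pre V₀ c) * u₀ * su2Quat (post V₀ c)) - 1‖ < 1 / 2
      rw [hpu₀]
      exact (norm_env_mul_star_sub_one_lt V₀ c hW₀ k).trans (by norm_num)
    -- the analytic datum
    obtain ⟨L, Dq, hΦ, hDq⟩ := exists_strictFDeriv_coneKf (c := w) (fun _ => emlWeight_nonneg P) (sum_emlWeight_lt_one c)
      (a := (η V₀).1) (fun k => norm_su2Quat _) (p := (η V₀).2.1) (q := (η V₀).2.2) (norm_su2Quat _) (norm_su2Quat _) hu₀ hg₀guard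
    -- the guard `< 1` on a product neighbourhood of `(η V₀, u₀)` in `Env × ℍ` (for differentiability of nearby fibres)
    have hGcont : ContinuousAt (fun z : ((Fin (offCard c) → ℍ) × ℍ × ℍ) × ℍ =>
        fun k => ‖z.1.1 k * star (z.1.2.1 * (‖z.2‖⁻¹ • z.2) * z.1.2.2) - 1‖) (η V₀, u₀) := by
      refine continuousAt_pi.mpr fun k => ?_
      have hz : ContinuousAt (fun z : ((Fin (offCard c) → ℍ) × ℍ × ℍ) × ℍ => ‖z.2‖⁻¹ • z.2) (η V₀, u₀) :=
        ((continuous_norm.continuousAt.comp continuousAt_snd).inv₀ (by simpa using norm_ne_zero_iff.mpr hu₀0)).smul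
          continuousAt_snd
      have ha : ContinuousAt (fun z : ((Fin (offCard c) → ℍ) × ℍ × ℍ) × ℍ => z.1.1 k) (η V₀, u₀) :=
        ((continuous_apply k).continuousAt.comp (continuousAt_fst.comp continuousAt_fst))
      have hp : ContinuousAt (fun z : ((Fin (offCard c) → ℍ) × ℍ × ℍ) × ℍ => z.1.2.1) (η V₀, u₀) :=
        continuousAt_fst.comp (continuousAt_snd.comp continuousAt_fst)
      have hq : ContinuousAt (fun z : ((Fin (offCard c) → ℍ) × ℍ × ℍ) × ℍ => z.1.2.2) (η V₀, u₀) :=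
        continuousAt_snd.comp (continuousAt_snd.comp continuousAt_fst)
      exact ((ha.mul ((hp.mul hz).mul hq).star).sub continuousAt_const).norm
    have hopen1 : IsOpen {f : Fin (offCard c) → ℝ | ∀ k, f k < 1} := by
      rw [show {f : Fin (offCard c) → ℝ | ∀ k, f k < 1} = ⋂ k, {f | f k < 1} by ext; simp]
      exact isOpen_iInter_of_finite fun k => isOpen_lt (continuous_apply k) continuous_const
    have hG₀ : (fun k => ‖(η V₀).1 k * star ((η V₀).2.1 * (‖u₀‖⁻¹ • u₀) * (η V₀).2.2) - 1‖) ∈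
        {f : Fin (offCard c) → ℝ | ∀ k, f k < 1} := fun k => by
      rw [hu₀, inv_one, one_smul]; exact (hg₀guard k).trans (by norm_num)
    obtain ⟨Ne, hNe, Nu, hNu, hNprod⟩ := mem_nhds_prod_iff.mp (hGcont.preimage_mem_nhds (hopen1.mem_nhds hG₀))
    -- the open set `S'` of private-bond values: inside `S`, with unit quaternion in `Nu`
    set S' : Set (Matrix.specialUnitaryGroup (Fin 2) ℂ) := S ∩ su2Quat ⁻¹' interior Nu with hS'
    have hS'o : IsOpen S' := hS.inter (continuous_su2Quat.isOpen_preimage _ isOpen_interior)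
    have hg₀S' : g₀ ∈ S' := ⟨hgS, mem_interior_iff_mem_nhds.mpr hNu⟩
    -- apply the parametric inverse function theorem
    have key := su2_fibrewise_of_hasStrictFDerivAt' (Env := (Fin (offCard c) → ℍ) × ℍ × ℍ) hS'o
      (K := fun U g => avgFun expMeanLogSU (update U (centralBond c) g) c)
      (fun U => (measurable_pi_apply c).comp ((measurable_avgFun expMeanLogSU measurable_expMeanLogSU_E).comp
        (measurable_update U)))
      (η := η) (t₀ := V₀) hηc.continuousAt
      (Φ := fun z : ((Fin (offCard c) → ℍ) × ℍ × ℍ) × ℍ => ‖z.2‖ • kf z.1.1 w (z.1.2.1 * (‖z.2‖⁻¹ • z.2) * z.1.2.2))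
      (g₀ := g₀) hg₀S' hΦ Dq hDq ?_ ?_ (B₁ c) (hB₁ c).1 (hB₁ c).2
    · obtain ⟨𝒰c, h𝒰c, B, W, hgB, hBB₁, hWo, hKW, hU⟩ := key
      refine ⟨𝒰c, h𝒰c, B, W, hgB, hBB₁, hWo, ?_, hU⟩
      have : avgFun expMeanLogSU (update V₀ (centralBond c) g₀) c ∈ W := hKW
      rwa [hV₀upd] at this
    · -- representation along configurations near `V₀`
      filter_upwards [h𝒰₂.mem_nhds hV𝒰₂] with U hU x hx hxS
      exact coneKf_env_eq hj U c hx (hsmall U hU _ hxS.1)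
    · -- differentiability of nearby fibres
      filter_upwards [hNe] with e he x hx hxS
      refine differentiableAt_coneKf w e hx fun k => ?_
      have hmem : (e, ‖x‖⁻¹ • x) ∈ Ne ×ˢ Nu := by
        refine Set.mk_mem_prod he ?_
        have : su2Quat (quatToSU2 x) ∈ interior Nu := hxS.2
        rw [su2Quat_quatToSU2 hx] at this
        exact interior_subset this
      have := hNprod hmem k
      change ‖e.1 k * star (e.2.1 * (‖‖x‖⁻¹ • x‖⁻¹ • (‖x‖⁻¹ • x)) * e.2.2) - 1‖ < 1 at this
      have hxx : ‖‖x‖⁻¹ • x‖⁻¹ • (‖x‖⁻¹ • x) = ‖x‖⁻¹ • x := by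
        rw [norm_smul, norm_inv, norm_norm, inv_mul_cancel₀ (norm_ne_zero_iff.mpr hx), inv_one, one_smul]
      rw [hxx] at this
      exact this
  -- assemble over the finitely many coarse bonds
  choose 𝒰c h𝒰c Bc Wc hgB hBB₁ hWo hAW hU using perBond
  have hinter : 𝒰₁ ∩ ⋂ c, 𝒰c c ∈ 𝓝 V₀ :=
    Filter.inter_mem (h𝒰₁.mem_nhds hV𝒰₁) (Filter.iInter_mem.mpr fun c => h𝒰c c)
  obtain ⟨𝒰, h𝒰sub, h𝒰o, hV𝒰⟩ := mem_nhds_iff.mp hinter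
  refine ⟨𝒰, h𝒰o, hV𝒰, fun U hU' => (h𝒰sub hU').1, Bc, Wc, fun c => ⟨hgB c, hBB₁ c, hWo c, hAW c⟩, fun U hU' c => ?_⟩
  have hUc : U ∈ 𝒰c c := Set.mem_iInter.mp (h𝒰sub hU').2 c
  rw [haarData_haar_eq]
  exact hU c U hUc

/-! ## §3 (O) ∧ (N) for one (0.4) step on the small fields -/

/-- **ONE STEP OF (0.4) WITH THE PRINTED `exp[mean log]` ON `SU(2)` IS AN OPEN MAP AND MEASURE-OPEN ON THE SMALL FIELDS**: standing
range `j + 1 ≤ m + K`, radius `δ₁ ≥ 0` with `((d+2)L)²δ₁/4 < δ₂`; for every open `O ⊆ {PlaqSmall δ₁}`: `Ū(O)` is open, and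
`dU(O ∩ Ū⁻¹N) = 0 ⇒ dV(N ∩ Ū(O)) = 0` for every measurable `N`. [folklore] -/
theorem oneStepSubmersion (hj : j + 1 ≤ P.m + P.K) {δ₁ : ℝ} (hδ : 0 ≤ δ₁)
    (hτ : ((((P.d + 2) * P.L : ℕ) : ℝ) ^ 2 / 4) * δ₁ < deltaSU (Fin 2))
    {O : Set (GaugeField P j (Matrix.specialUnitaryGroup (Fin 2) ℂ))} (hO : IsOpen O) (hOD : O ⊆ {U | PlaqSmall δ₁ U}) :
    IsOpen ((blockAvg (P := P) (j := j) expMeanLogSU).avg '' O) ∧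
      ∀ N : Set (GaugeField P (j + 1) (Matrix.specialUnitaryGroup (Fin 2) ℂ)), MeasurableSet N →
        fieldMeasure P j (Matrix.specialUnitaryGroup (Fin 2) ℂ) (O ∩ (blockAvg (P := P) (j := j) expMeanLogSU).avg ⁻¹' N) = 0 →
          fieldMeasure P (j + 1) (Matrix.specialUnitaryGroup (Fin 2) ℂ) (N ∩ (blockAvg (P := P) (j := j) expMeanLogSU).avg '' O) = 0 := by
  classical
  haveI := Literature.MathematicalPhysics.QuantumLattice.secondCountableTopology_su2
  haveI : IsProbabilityMeasure (HaarData.haar : Measure (Matrix.specialUnitaryGroup (Fin 2) ℂ)) := HaarData.isProb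
  haveI : (HaarData.haar : Measure (Matrix.specialUnitaryGroup (Fin 2) ℂ)).IsOpenPosMeasure := by
    rw [haarData_haar_eq]; unfold haarProbability; infer_instance
  rw [blockAvg_avg]
  unfold fieldMeasure
  exact isOpen_image_and_measureOpen_of_fibrewise (HaarData.haar : Measure (Matrix.specialUnitaryGroup (Fin 2) ℂ))
    (isLocal_avgFun hj expMeanLogSU) (centralBond_injective hj) (measurable_avgFun expMeanLogSU measurable_expMeanLogSU_E)
    (fibrewise_avgFun hj hδ hτ) hO hOD

/-! ## §4 The families: (O) ∧ (N) at every level of every run, «Lemma B» below a radius, and `posOnSmall` from the small lift ALONE -/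

section Family

open Literature.MathematicalPhysics.QuantumFieldTheory.Balaban1983to89.T3ContinuumYM3Torus
open Literature.MathematicalPhysics.QuantumFieldTheory.Balaban1983to89.T3UnitLawDensityEML (ℰp)
open Literature.MathematicalPhysics.QuantumFieldTheory.Balaban1983to89.T3UnitScaleTilt
open Literature.MathematicalPhysics.QuantumFieldTheory.Balaban1983to89.T3TiltDescent
open Literature.MathematicalPhysics.QuantumFieldTheory.Balaban1983to89.T3SmallLiftHistory
open Summit.QuantumFields.YangMills.Theorems.PosOnSmallReduction

/-- **THE ONE-STEP SUBMERSION HYPOTHESIS OF `posOnSmall_of_smallLift_of_oneStepSubmersion`, PROVED**: for every block size `L` the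
radius `δ₁(L) = δ₂/((5L)² + 1) > 0` works for every step of every run of every `d = 3` family of block size `L`. [folklore] -/
theorem oneStepSubmersion_family :
    ∀ L : ℕ, ∃ δ₁ : ℝ, 0 < δ₁ ∧ ∀ F : T3Family, F.L = L → ∀ K j : ℕ, j + 1 ≤ F.m + K →
      (∀ O : Set (GaugeField (F.P K) j (Matrix.specialUnitaryGroup (Fin 2) ℂ)), IsOpen O → O ⊆ {U | PlaqSmall δ₁ U} →
        IsOpen ((BlockAveraging.blockAvg (P := F.P K) (j := j) ℰp).avg '' O)) ∧
      (∀ O : Set (GaugeField (F.P K) j (Matrix.specialUnitaryGroup (Fin 2) ℂ)), IsOpen O → O ⊆ {U | PlaqSmall δ₁ U} →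
        ∀ A : Set (GaugeField (F.P K) (j + 1) (Matrix.specialUnitaryGroup (Fin 2) ℂ)), MeasurableSet A →
          fieldMeasure (F.P K) j (Matrix.specialUnitaryGroup (Fin 2) ℂ)
              (O ∩ (BlockAveraging.blockAvg (P := F.P K) (j := j) ℰp).avg ⁻¹' A) = 0 →
            fieldMeasure (F.P K) (j + 1) (Matrix.specialUnitaryGroup (Fin 2) ℂ)
              (A ∩ (BlockAveraging.blockAvg (P := F.P K) (j := j) ℰp).avg '' O) = 0) := by
  intro L
  set δ₁ : ℝ := deltaSU (Fin 2) / ((((3 + 2) * L : ℕ) : ℝ) ^ 2 + 1) with hδ₁_def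
  have hsq : (0 : ℝ) < (((3 + 2) * L : ℕ) : ℝ) ^ 2 + 1 := by positivity
  have hδ₁ : 0 < δ₁ := div_pos deltaSU_pos hsq
  refine ⟨δ₁, hδ₁, fun F hFL K j hj => ?_⟩
  subst hFL
  have hτ : ((((F.P K).d + 2) * (F.P K).L : ℕ) : ℝ) ^ 2 / 4 * δ₁ < deltaSU (Fin 2) := by
    have e : ((((F.P K).d + 2) * (F.P K).L : ℕ) : ℝ) = (((3 + 2) * F.L : ℕ) : ℝ) := rfl
    rw [e]
    set x : ℝ := (((3 + 2) * F.L : ℕ) : ℝ) ^ 2 with hx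
    have hx0 : 0 ≤ x := by positivity
    have hd : 0 < deltaSU (Fin 2) := deltaSU_pos
    have h1 : x / 4 * δ₁ = deltaSU (Fin 2) * (x / (4 * (x + 1))) := by
      rw [hδ₁_def]; field_simp
    have h2 : x / (4 * (x + 1)) < 1 := by
      rw [div_lt_one (by positivity)]; linarith
    calc x / 4 * δ₁ = deltaSU (Fin 2) * (x / (4 * (x + 1))) := h1
      _ < deltaSU (Fin 2) * 1 := mul_lt_mul_of_pos_left h2 hd
      _ = deltaSU (Fin 2) := mul_one _
  have hj' : j + 1 ≤ (F.P K).m + (F.P K).K := hj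
  exact ⟨fun O hO hOD => (oneStepSubmersion hj' hδ₁.le hτ hO hOD).1,
    fun O hO hOD => (oneStepSubmersion hj' hδ₁.le hτ hO hOD).2⟩

/-- **«LEMMA B» BELOW A RADIUS — PROVED**: for every block size `L` there is `δ₁ > 0` such that for every family of block size `L`,
every coupling `γ > 0` and every threshold profile with `θBal(i) ≤ δ₁` for all `i`, `FibrePositivity F γ h (histGood F ℰp θBal K n)`
holds for all `n ≤ K` (the honest cut of v2's `stub_fibrePositivity`). [cite: Balaban1985UV3, (2) p.256, (7) p.257 and (41) p.266] -/
theorem fibrePositivityBelow :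
    ∀ L : ℕ, ∃ δ₁ : ℝ, 0 < δ₁ ∧ ∀ F : T3Family, F.L = L → ∀ (γ b₀ p₀ : ℝ) (n K : ℕ) (h : n ≤ K),
      0 < γ → (∀ i, θBal F.L γ b₀ p₀ i ≤ δ₁) → FibrePositivity F γ h (histGood F ℰp (θBal F.L γ b₀ p₀) K n) :=
  fibrePositivityBelow_of_oneStepSubmersion oneStepSubmersion_family

/-- **`posOnSmall` ⇐ ONE-STEP SMALL LIFT ALONE.**  The registered statement `posOnSmall` of the crux line (= the old
`stub_posOnSmall`, split by p428548 into `stub_oneStepSmallLift` ∧ `stub_fibrePositivity`) follows from the small-lift schema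
`[∀ L, ∃ κ δ₀, κ√L ≤ 1 ∧ 0 < δ₀ ∧ OneStepSmallLift]` — the shape of `stub_oneStepSmallLift` VERBATIM — with NO fibre-positivity
hypothesis: «Lemma B» is discharged in the regime the composition uses. [cite: Balaban1985UV3, (2) p.256, (7) p.257 and (41) p.266] -/
theorem posOnSmall_of_oneStepSmallLift
    (hlift : ∀ L : ℕ, ∃ κ δ₀ : ℝ, κ * Real.sqrt L ≤ 1 ∧ 0 < δ₀ ∧
      ∀ F : T3Family, F.L = L → OneStepSmallLift F ℰp κ δ₀) :
    ∀ (L m : ℕ), 0 < m → ∀ (b₀ p₀ : ℝ), 0 < b₀ → 2 < p₀ → ∃ γ₁ : ℝ, 0 < γ₁ ∧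
      ∀ (F : T3Family) (γ : ℝ), F.L = L → 0 < γ → γ ≤ γ₁ →
        ∀ K, ∀ᵐ V ∂fieldMeasure (F.P (K / m)) 0 (Matrix.specialUnitaryGroup (Fin 2) ℂ),
          PlaqSmall (θBal F.L γ b₀ p₀ (K / m)) V →
            0 < heightDensity F γ (Nat.div_le_self K m) (histGood F ℰp (θBal F.L γ b₀ p₀) K (K / m)) V ∧
            0 < heightDensity F γ ((Nat.div_le_self K m).trans (Nat.le_succ K))
                  (histGood F ℰp (θBal F.L γ b₀ p₀) (K + 1) (K / m)) V :=
  posOnSmall_of_smallLift_of_oneStepSubmersion hlift oneStepSubmersion_family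

end Family

end Summit.QuantumFields.YangMills.Theorems.OneStepSubmersion

end
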